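import Mathlib
import HarnessLib
import Literature.MathematicalPhysics.QuantumManyBody.BoseEinsteinCondensation
import Summits.AtomisticToContinuum.BoseEinsteinCondensation.Theorems.NumberPhaseSandwichKinematicCalculus

/-! # NumberPhaseSandwich — the kinematic (uncertainty) floor for the relative-number variance (part 2 of 2)

Helper for the crux `FluctuationFloor` (stmt-AtomisticToContinuum-32638) of route NumberPhaseSandwich, near-pivot
stub `stub_floor_nearPivot` (decomp-a2c lens-6 g10; LAND ASK-4b). With the objects of part 1
(`NumberPhaseSandwichKinematicCalculus`: `G(X) = ∑ₚ g(xₚ)`, `gradSq`, `lapG`, `DPsi`), integration by parts of the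
vector field `(G − a)|Ψ|² ∇G` gives the commutator identity
`∫ |∇G|²|Ψ|² = −2 Re ∫ (G − a) conj(Ψ)·(∇G·∇Ψ) − ∫ (ΔG)(G − a)|Ψ|²`
and hence, by Cauchy–Schwarz, the uncertainty-type floor
`(∫ |∇G|²|Ψ|²)² ≤ (∫ |G − m|²|Ψ|²) · (2‖∇G·∇Ψ‖₂ + ‖ΔG Ψ‖₂)²` for every `m ∈ ℂ`
(`[A,[H,A]] = 2|∇G|²` for `A = G`, `H = −Δ + V`). With `g = h_c − h_{c'}` (the smooth cell bumps of the route) the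
left side is `≍ (ρℓ)²` and the right bracket is local number × local kinetic energy in the sibling pair: the floor
reduces the near-pivot stub to uniform-in-cell local bounds; `kinematic_floor_iInf` states the floor directly
against the route's `⨅ m, ∫⁻ ‖G − m‖₊² ‖Ψ‖₊²` object. 0 sorry. -/

noncomputable section

namespace Summit.AtomisticToContinuum.BoseEinsteinCondensation.Theorems.NumberPhaseSandwichKinematicFloor

open Literature.MathematicalPhysics.QuantumManyBody.BoseGas hiding gradSq
open MeasureTheory Finset
open scoped NNReal ENNReal
open Summit.AtomisticToContinuum.BoseEinsteinCondensation.Theorems.NumberPhaseSandwichKinematicCalculus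

variable {N : ℕ} {L : ℝ}

section Main
variable (Ψ : TrialState N L) {g : Space → ℝ} (hg : ContDiff ℝ 2 g)
include hg

/-- the dressed number `G g` is continuous for `C²` `g`. -/
theorem continuous_G : Continuous (G (N := N) g) := (differentiable_G (hg.differentiable (by norm_num))).continuous

/-- `|∇G|²` is continuous for `C²` `g`. -/
theorem continuous_gradSq : Continuous (gradSq (N := N) g) := by
  have hc1 : ∀ j, Continuous (pd g j) := fun j => continuous_pd (hg.of_le (by norm_num)) j
  unfold gradSq; fun_prop

/-- `ΔG` is continuous for `C²` `g`. -/
theorem continuous_lapG : Continuous (lapG (N := N) g) := by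
  have hc2 : ∀ j, Continuous (pd (pd g j) j) := fun j => continuous_pd (contDiff_pd hg j) j
  unfold lapG; fun_prop

/-- the gradient pairing `∇G·∇Ψ` is continuous. -/
theorem continuous_DPsi : Continuous (DPsi g Ψ.ψ) := by
  have hc1 : ∀ j, Continuous (pd g j) := fun j => continuous_pd (hg.of_le (by norm_num)) j
  have hc3 : ∀ p j, Continuous fun X => fderiv ℝ Ψ.ψ X (dirVec p j) := fun p j => continuous_fderiv_psi Ψ _
  unfold DPsi; fun_prop

omit hg in
/-- the gradient pairing `∇G·∇Ψ` has compact support. -/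
theorem hasCompactSupport_DPsi : HasCompactSupport (DPsi g Ψ.ψ) := by
  refine ((hasCompactSupport_psi Ψ).fderiv (𝕜 := ℝ)).mono ?_
  intro X hX
  rw [Function.mem_support] at hX ⊢
  contrapose! hX
  simp [DPsi, hX]

omit hg in
/-- `F · ‖Ψ‖` has compact support for any `F`. -/
theorem hasCompactSupport_mul_norm (F : Config N → ℝ) : HasCompactSupport fun X => F X * ‖Ψ.ψ X‖ :=
  (hasCompactSupport_psi Ψ).norm.mul_left

omit hg in
/-- `F · ‖Ψ‖²` has compact support for any `F`. -/
theorem hasCompactSupport_mul_normSq (F : Config N → ℝ) : HasCompactSupport fun X => F X * ‖Ψ.ψ X‖ ^ 2 :=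
  (hasCompactSupport_normSq Ψ).mul_left

/-! ## The commutator identity `∫ |∇G|²|Ψ|² = −∫ (G−a)ΔG|Ψ|² − 2 Re ∫ (G−a) conj Ψ (∇G·∇Ψ)` -/

/-- **Commutator identity** `∫ |∇G|²|Ψ|² = −∫ (G−a)ΔG|Ψ|² − 2 Re ∫ (G−a) conj Ψ (∇G·∇Ψ)` (sum of the per-direction integrations by parts). -/
theorem commutator_identity (a : ℝ) :
    ∫ X, gradSq g X * ‖Ψ.ψ X‖ ^ 2 =
      -(∫ X, (G g X - a) * lapG g X * ‖Ψ.ψ X‖ ^ 2)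
        - ∫ X, 2 * (G g X - a) * ((starRingEnd ℂ) (Ψ.ψ X) * DPsi g Ψ.ψ X).re := by
  have hψc := Ψ.contDiff.continuous
  have hw := (contDiff_normSq Ψ).continuous
  have hGc := continuous_G (N := N) hg
  have hc1 : ∀ j, Continuous (pd g j) := fun j => continuous_pd (hg.of_le (by norm_num)) j
  have hc2 : ∀ j, Continuous (pd (pd g j) j) := fun j => continuous_pd (contDiff_pd hg j) j
  have hc3 : ∀ p j, Continuous fun X => fderiv ℝ Ψ.ψ X (dirVec p j) := fun p j => continuous_fderiv_psi Ψ _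
  -- sum the per-direction identities
  have hsum : ∑ p : Fin N, ∑ j : Fin 3, ∫ X, fpj g a p j X * fderiv ℝ (fun X => ‖Ψ.ψ X‖ ^ 2) X (dirVec p j) =
      ∑ p : Fin N, ∑ j : Fin 3,
        -(∫ X, (pd g j (X p) ^ 2 + (G g X - a) * pd (pd g j) j (X p)) * ‖Ψ.ψ X‖ ^ 2) :=
    Finset.sum_congr rfl fun p _ => Finset.sum_congr rfl fun j _ => ibp_pj Ψ hg a p j
  -- integrability of the summands
  have hiL : ∀ p j, Integrable fun X => fpj g a p j X * fderiv ℝ (fun X => ‖Ψ.ψ X‖ ^ 2) X (dirVec p j) := by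
    intro p j
    refine Continuous.integrable_of_hasCompactSupport ((continuous_fpj hg a p j).mul
      (((contDiff_normSq Ψ).continuous_fderiv one_ne_zero).clm_apply continuous_const)) ?_
    exact ((hasCompactSupport_normSq Ψ).fderiv_apply (𝕜 := ℝ) (dirVec p j)).mul_left
  have hiR : ∀ p j, Integrable fun X => (pd g j (X p) ^ 2 + (G g X - a) * pd (pd g j) j (X p)) * ‖Ψ.ψ X‖ ^ 2 := by
    intro p j
    refine Continuous.integrable_of_hasCompactSupport ?_ (hasCompactSupport_mul_normSq Ψ _)
    fun_prop
  -- the left sum as one integral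
  have hL : ∑ p : Fin N, ∑ j : Fin 3, ∫ X, fpj g a p j X * fderiv ℝ (fun X => ‖Ψ.ψ X‖ ^ 2) X (dirVec p j) =
      ∫ X, 2 * (G g X - a) * ((starRingEnd ℂ) (Ψ.ψ X) * DPsi g Ψ.ψ X).re := by
    have inner : ∀ p : Fin N, ∑ j : Fin 3, ∫ X, fpj g a p j X * fderiv ℝ (fun X => ‖Ψ.ψ X‖ ^ 2) X (dirVec p j)
        = ∫ X, ∑ j : Fin 3, fpj g a p j X * fderiv ℝ (fun X => ‖Ψ.ψ X‖ ^ 2) X (dirVec p j) :=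
      fun p => (integral_finsetSum Finset.univ fun j _ => hiL p j).symm
    simp_rw [inner]
    rw [← integral_finsetSum Finset.univ fun p _ => integrable_finsetSum Finset.univ fun j _ => hiL p j]
    refine integral_congr_ae (Filter.Eventually.of_forall fun X => ?_)
    have hd : ∀ p j, fderiv ℝ (fun X => ‖Ψ.ψ X‖ ^ 2) X (dirVec p j) =
        2 * ((starRingEnd ℂ) (Ψ.ψ X) * fderiv ℝ Ψ.ψ X (dirVec p j)).re :=
      fun p j => norm_sq_fderiv X _ (Ψ.contDiff.differentiable one_ne_zero X)
    simp only [hd, fpj, DPsi, Finset.mul_sum, Complex.re_sum]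
    refine Finset.sum_congr rfl fun p _ => Finset.sum_congr rfl fun j _ => ?_
    simp only [Complex.mul_re, Complex.mul_im, Complex.ofReal_re, Complex.ofReal_im, zero_mul, sub_zero, add_zero]
    ring
  -- the right sum as one integral
  have hR : ∑ p : Fin N, ∑ j : Fin 3,
      -(∫ X, (pd g j (X p) ^ 2 + (G g X - a) * pd (pd g j) j (X p)) * ‖Ψ.ψ X‖ ^ 2) =
      -((∫ X, gradSq g X * ‖Ψ.ψ X‖ ^ 2) + ∫ X, (G g X - a) * lapG g X * ‖Ψ.ψ X‖ ^ 2) := by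
    simp only [Finset.sum_neg_distrib]
    congr 1
    have inner : ∀ p : Fin N, ∑ j : Fin 3, ∫ X, (pd g j (X p) ^ 2 + (G g X - a) * pd (pd g j) j (X p)) * ‖Ψ.ψ X‖ ^ 2
        = ∫ X, ∑ j : Fin 3, (pd g j (X p) ^ 2 + (G g X - a) * pd (pd g j) j (X p)) * ‖Ψ.ψ X‖ ^ 2 :=
      fun p => (integral_finsetSum Finset.univ fun j _ => hiR p j).symm
    simp_rw [inner]
    rw [← integral_finsetSum Finset.univ fun p _ => integrable_finsetSum Finset.univ fun j _ => hiR p j]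
    rw [← integral_add]
    · refine integral_congr_ae (Filter.Eventually.of_forall fun X => ?_)
      simp only [gradSq, lapG, Finset.sum_mul, Finset.mul_sum, ← Finset.sum_add_distrib]
      refine Finset.sum_congr rfl fun p _ => Finset.sum_congr rfl fun j _ => ?_
      ring
    · exact ((continuous_gradSq (N := N) hg).mul hw).integrable_of_hasCompactSupport
        (hasCompactSupport_mul_normSq Ψ _)
    · refine Continuous.integrable_of_hasCompactSupport ?_ (hasCompactSupport_mul_normSq Ψ _)
      have := continuous_lapG (N := N) hg
      fun_prop
  rw [hL, hR] at hsum
  linarith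

/-! ## The kinematic floor -/

/-- **Kinematic (uncertainty) floor**, real form: for every `a ∈ ℝ`,
`(∫ |∇G|²|Ψ|²)² ≤ (∫ (G−a)²|Ψ|²) · (2‖∇G·∇Ψ‖₂ + ‖ΔG Ψ‖₂)²`. -/
theorem kinematic_floor_real (a : ℝ) :
    (∫ X, gradSq g X * ‖Ψ.ψ X‖ ^ 2) ^ 2 ≤
      (∫ X, (G g X - a) ^ 2 * ‖Ψ.ψ X‖ ^ 2) *
        (2 * Real.sqrt (∫ X, ‖DPsi g Ψ.ψ X‖ ^ 2) + Real.sqrt (∫ X, lapG g X ^ 2 * ‖Ψ.ψ X‖ ^ 2)) ^ 2 := by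
  have hψc := Ψ.contDiff.continuous
  have hGc := continuous_G (N := N) hg
  have hlap := continuous_lapG (N := N) hg
  have hD := continuous_DPsi Ψ hg
  set A := ∫ X, (G g X - a) ^ 2 * ‖Ψ.ψ X‖ ^ 2 with hA
  set T := ∫ X, ‖DPsi g Ψ.ψ X‖ ^ 2 with hT
  set C := ∫ X, lapG g X ^ 2 * ‖Ψ.ψ X‖ ^ 2 with hC
  set Γ := ∫ X, gradSq g X * ‖Ψ.ψ X‖ ^ 2 with hΓ
  have hΓ0 : 0 ≤ Γ := integral_nonneg fun X => mul_nonneg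
    (Finset.sum_nonneg fun p _ => Finset.sum_nonneg fun j _ => sq_nonneg _) (sq_nonneg _)
  have hA0 : 0 ≤ A := integral_nonneg fun X => mul_nonneg (sq_nonneg _) (sq_nonneg _)
  -- F := (G - a)‖Ψ‖, H₁ := lapG ‖Ψ‖, H₂ := ‖DPsi‖
  have hF : Continuous fun X => (G g X - a) * ‖Ψ.ψ X‖ := by fun_prop
  have hFc : HasCompactSupport fun X => (G g X - a) * ‖Ψ.ψ X‖ := hasCompactSupport_mul_norm Ψ _
  have hH1 : Continuous fun X => lapG g X * ‖Ψ.ψ X‖ := by fun_prop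
  have hH1c : HasCompactSupport fun X => lapG g X * ‖Ψ.ψ X‖ := hasCompactSupport_mul_norm Ψ _
  have hH2 : Continuous fun X => ‖DPsi g Ψ.ψ X‖ := hD.norm
  have hH2c : HasCompactSupport fun X => ‖DPsi g Ψ.ψ X‖ := (hasCompactSupport_DPsi Ψ).norm
  have hF2 : ∫ X, ((G g X - a) * ‖Ψ.ψ X‖) ^ 2 = A := by
    rw [hA]; exact integral_congr_ae (Filter.Eventually.of_forall fun X => mul_pow _ _ 2)
  have hH12 : ∫ X, (lapG g X * ‖Ψ.ψ X‖) ^ 2 = C := by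
    rw [hC]; exact integral_congr_ae (Filter.Eventually.of_forall fun X => mul_pow _ _ 2)
  -- bound 1
  have hb1 : |∫ X, (G g X - a) * lapG g X * ‖Ψ.ψ X‖ ^ 2| ≤ Real.sqrt A * Real.sqrt C := by
    have := abs_integral_mul_le hF hH1 hFc hH1c
    rw [hF2, hH12] at this
    refine Eq.trans_le ?_ this
    congr 1
    refine integral_congr_ae (Filter.Eventually.of_forall fun X => ?_)
    show (G g X - a) * lapG g X * ‖Ψ.ψ X‖ ^ 2 = (G g X - a) * ‖Ψ.ψ X‖ * (lapG g X * ‖Ψ.ψ X‖)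
    ring
  -- bound 2
  have hb2 : |∫ X, 2 * (G g X - a) * ((starRingEnd ℂ) (Ψ.ψ X) * DPsi g Ψ.ψ X).re| ≤
      2 * (Real.sqrt A * Real.sqrt T) := by
    have hcs := abs_integral_mul_le (F := fun X => |G g X - a| * ‖Ψ.ψ X‖) (H := fun X => ‖DPsi g Ψ.ψ X‖)
      (by fun_prop) hH2 ((hasCompactSupport_psi Ψ).norm.mul_left) hH2c
    have hF2' : ∫ X, (|G g X - a| * ‖Ψ.ψ X‖) ^ 2 = A := by
      rw [hA]; refine integral_congr_ae (Filter.Eventually.of_forall fun X => ?_)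
      show (|G g X - a| * ‖Ψ.ψ X‖) ^ 2 = (G g X - a) ^ 2 * ‖Ψ.ψ X‖ ^ 2
      rw [mul_pow, sq_abs]
    rw [hF2', ← hT] at hcs
    have hpt : ∀ X, |2 * (G g X - a) * ((starRingEnd ℂ) (Ψ.ψ X) * DPsi g Ψ.ψ X).re| ≤
        2 * (|G g X - a| * ‖Ψ.ψ X‖ * ‖DPsi g Ψ.ψ X‖) := by
      intro X
      rw [abs_mul, abs_mul, abs_two]
      have hre : |((starRingEnd ℂ) (Ψ.ψ X) * DPsi g Ψ.ψ X).re| ≤ ‖Ψ.ψ X‖ * ‖DPsi g Ψ.ψ X‖ := by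
        refine (Complex.abs_re_le_norm _).trans ?_
        rw [norm_mul, Complex.norm_conj]
      calc 2 * |G g X - a| * |((starRingEnd ℂ) (Ψ.ψ X) * DPsi g Ψ.ψ X).re|
          ≤ 2 * |G g X - a| * (‖Ψ.ψ X‖ * ‖DPsi g Ψ.ψ X‖) := by gcongr
        _ = _ := by ring
    have hint : Integrable fun X => 2 * (|G g X - a| * ‖Ψ.ψ X‖ * ‖DPsi g Ψ.ψ X‖) := by
      refine Continuous.integrable_of_hasCompactSupport (by fun_prop) ?_
      exact ((hasCompactSupport_psi Ψ).norm.mul_left.mul_right).mul_left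
    calc |∫ X, 2 * (G g X - a) * ((starRingEnd ℂ) (Ψ.ψ X) * DPsi g Ψ.ψ X).re|
        ≤ ∫ X, |2 * (G g X - a) * ((starRingEnd ℂ) (Ψ.ψ X) * DPsi g Ψ.ψ X).re| := abs_integral_le_integral_abs
      _ ≤ ∫ X, 2 * (|G g X - a| * ‖Ψ.ψ X‖ * ‖DPsi g Ψ.ψ X‖) :=
          integral_mono_of_nonneg (Filter.Eventually.of_forall fun X => abs_nonneg _) hint
            (Filter.Eventually.of_forall hpt)
      _ = 2 * ∫ X, (|G g X - a| * ‖Ψ.ψ X‖) * ‖DPsi g Ψ.ψ X‖ := by rw [integral_const_mul]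
      _ ≤ 2 * (Real.sqrt A * Real.sqrt T) := by
          gcongr; exact (le_abs_self _).trans hcs
  -- assemble
  have hid : Γ = -(∫ X, (G g X - a) * lapG g X * ‖Ψ.ψ X‖ ^ 2)
      - ∫ X, 2 * (G g X - a) * ((starRingEnd ℂ) (Ψ.ψ X) * DPsi g Ψ.ψ X).re := commutator_identity Ψ hg a
  have hΓle : Γ ≤ Real.sqrt A * (2 * Real.sqrt T + Real.sqrt C) := by
    have h1 := neg_le_abs (∫ X, (G g X - a) * lapG g X * ‖Ψ.ψ X‖ ^ 2)
    have h2 := neg_le_abs (∫ X, 2 * (G g X - a) * ((starRingEnd ℂ) (Ψ.ψ X) * DPsi g Ψ.ψ X).re)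
    have h3 : Real.sqrt A * (2 * Real.sqrt T + Real.sqrt C) =
        Real.sqrt A * Real.sqrt C + 2 * (Real.sqrt A * Real.sqrt T) := by ring
    linarith [hb1, hb2, hid, h1, h2, h3]
  have hK0 : 0 ≤ 2 * Real.sqrt T + Real.sqrt C := by positivity
  calc Γ ^ 2 ≤ (Real.sqrt A * (2 * Real.sqrt T + Real.sqrt C)) ^ 2 := pow_le_pow_left₀ hΓ0 hΓle 2
    _ = A * (2 * Real.sqrt T + Real.sqrt C) ^ 2 := by rw [mul_pow, Real.sq_sqrt hA0]

/-- **Kinematic floor**, complex-shift form (the route's variance is an infimum over `m ∈ ℂ`). -/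
theorem kinematic_floor (m : ℂ) :
    (∫ X, gradSq g X * ‖Ψ.ψ X‖ ^ 2) ^ 2 ≤
      (∫ X, ‖(G g X : ℂ) - m‖ ^ 2 * ‖Ψ.ψ X‖ ^ 2) *
        (2 * Real.sqrt (∫ X, ‖DPsi g Ψ.ψ X‖ ^ 2) + Real.sqrt (∫ X, lapG g X ^ 2 * ‖Ψ.ψ X‖ ^ 2)) ^ 2 := by
  refine (kinematic_floor_real Ψ hg m.re).trans (mul_le_mul_of_nonneg_right ?_ (sq_nonneg _))
  refine integral_mono_of_nonneg (Filter.Eventually.of_forall fun X => mul_nonneg (sq_nonneg _) (sq_nonneg _))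
    ?_ (Filter.Eventually.of_forall fun X => ?_)
  · refine Continuous.integrable_of_hasCompactSupport ?_ (hasCompactSupport_mul_normSq Ψ _)
    have hGc := continuous_G (N := N) hg
    exact (((Complex.continuous_ofReal.comp hGc).sub continuous_const).norm.pow 2).mul
      (Ψ.contDiff.continuous.norm.pow 2)
  · have h1 : ‖(G g X : ℂ) - m‖ ^ 2 = (G g X - m.re) ^ 2 + m.im ^ 2 := by
      rw [Complex.sq_norm, Complex.normSq_apply]
      simp only [Complex.sub_re, Complex.ofReal_re, Complex.sub_im, Complex.ofReal_im, zero_sub]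
      ring
    have h2 : (G g X - m.re) ^ 2 ≤ ‖(G g X : ℂ) - m‖ ^ 2 := by rw [h1]; nlinarith [sq_nonneg m.im]
    exact mul_le_mul_of_nonneg_right h2 (sq_nonneg _)

/-- The `∫⁻`-form of the second moment of the dressed number about `m ∈ ℂ` (the integrand of the route's
`FluctuationFloor` object, with `G g X = ∑ₚ g (X p)`) equals `ENNReal.ofReal` of the Bochner integral. -/
theorem lintegral_moment_eq_ofReal (m : ℂ) :
    ∫⁻ X, (‖(G g X : ℂ) - m‖₊ : ℝ≥0∞) ^ 2 * (‖Ψ.ψ X‖₊ : ℝ≥0∞) ^ 2 =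
      ENNReal.ofReal (∫ X, ‖(G g X : ℂ) - m‖ ^ 2 * ‖Ψ.ψ X‖ ^ 2) := by
  have hGc := continuous_G (N := N) hg
  have hInt : Integrable (fun X => ‖(G g X : ℂ) - m‖ ^ 2 * ‖Ψ.ψ X‖ ^ 2) := by
    refine Continuous.integrable_of_hasCompactSupport ?_ (hasCompactSupport_mul_normSq Ψ _)
    exact (((Complex.continuous_ofReal.comp hGc).sub continuous_const).norm.pow 2).mul
      (Ψ.contDiff.continuous.norm.pow 2)
  rw [ofReal_integral_eq_lintegral_ofReal hInt
    (Filter.Eventually.of_forall fun X => mul_nonneg (sq_nonneg _) (sq_nonneg _))]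
  exact lintegral_congr fun X => nnnorm_sq_mul_nnnorm_sq _ _

/-- **Kinematic floor, route form.** For every trial state `Ψ` and every `C²` one-body function `g`,
`ofReal( (∫ |∇G|²|Ψ|²)² / (2‖∇G·∇Ψ‖₂ + ‖ΔG Ψ‖₂)² ) ≤ ⨅_{m ∈ ℂ} ∫⁻ ‖G − m‖₊² ‖Ψ‖₊²` — the right side is
literally the variance object of `FluctuationFloor` (stmt-AtomisticToContinuum-32638) once `g = h_c − h_{c'}`
(unconditional: if the bracket vanishes the left side is `ofReal (x / 0) = 0`). -/
theorem kinematic_floor_iInf :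
    ENNReal.ofReal ((∫ X, gradSq g X * ‖Ψ.ψ X‖ ^ 2) ^ 2 /
        (2 * Real.sqrt (∫ X, ‖DPsi g Ψ.ψ X‖ ^ 2) + Real.sqrt (∫ X, lapG g X ^ 2 * ‖Ψ.ψ X‖ ^ 2)) ^ 2) ≤
      ⨅ m : ℂ, ∫⁻ X, (‖(G g X : ℂ) - m‖₊ : ℝ≥0∞) ^ 2 * (‖Ψ.ψ X‖₊ : ℝ≥0∞) ^ 2 := by
  refine le_iInf fun m => (ENNReal.ofReal_le_ofReal ?_).trans_eq (lintegral_moment_eq_ofReal Ψ hg m).symm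
  rcases (sq_nonneg (2 * Real.sqrt (∫ X, ‖DPsi g Ψ.ψ X‖ ^ 2) +
      Real.sqrt (∫ X, lapG g X ^ 2 * ‖Ψ.ψ X‖ ^ 2))).eq_or_lt with h0 | hpos
  · rw [← h0, div_zero]
    exact integral_nonneg fun X => mul_nonneg (sq_nonneg _) (sq_nonneg _)
  · rw [div_le_iff₀ hpos]
    exact kinematic_floor Ψ hg m

end Main

end Summit.AtomisticToContinuum.BoseEinsteinCondensation.Theorems.NumberPhaseSandwichKinematicFloor

end
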